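import Mathlib.Algebra.Group.InjSurj
import Literature.AlgebraicGeometry.Frobenioids.RlfStructure
import Literature.AnabelianGeometry.EtaleTheta.TemperedFrobenioid
import Literature.AnabelianGeometry.EtaleTheta.FrdIVocabulary

/-!
# [EtTh] Def 3.6 (i): `Φ₀^ℝ(Y)` is integral (cancellative) at the tree's [FrdI] vocabulary — the binder
# `hInt` DISCHARGED for every realified datum

S. Mochizuki, *The étale theta function …*, Publ. RIMS **45** (2009) [MochizukiEtTh2009], Def. 3.6 (i), PDF p.76
("`Φ₀^ℝ := Φ₀^rlf`, where `Φ₀^rlf` is as in [Mzk17], Definition 2.4, (i)"); S. Mochizuki, *The geometry of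
Frobenioids I* [MochizukiFrdI2008], Def. 2.4 (i)(c), kurims p.47–48 (`M^rlf ⊆ ∏_𝔭 M^rlf_𝔭` — a submonoid of a
product of copies of `ℝ_{≥0}`, hence integral).

The L2 discharges of [EtTh] Def. 3.6 (ii)(b) / Cor. 3.8 / Thm. 3.7 (ii) (`Discharge/Sec3Def36NonzeroConstants.lean`,
abc-iut-w4-d008; `Discharge/Sec3Thm37RatStdOfLine.lean`, `…OfCnst`, abc-iut-w5-d250; the Cor. 3.8 knits) carry
the binder `hInt : ∀ Y, IsCancelMul (T.ΦR.obj Y)` ("`Φ₀^ℝ(Y)` is integral").  Over abc-iut-L2-t3's ABSTRACT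
vocabulary `V : FrdIMonoidStub` it is not derivable (`T.ΦR` is tied to `Φ₀` only through the free predicate
`V.IsRealification`), and abc-iut-w4-d008's `RealifiedDivisorMonoids.ofRlfZ_isCancelMul`
(`Discharge/Sec3ConstantLineOfRlfZ.lean`) discharges it for the CONSTRUCTED datum `ofRlfZ dm hpf`.  This
proof-only file (abc-iut-w5-d135) discharges it for EVERY `T : RealifiedDivisorMonoids treeMonoidVocab`: at the
canonical vocabulary the field `isRealification` reads `IsRealificationVia (Φ₀ Y) (Φ₀^ℝ Y) (toR Y)` — an
isomorphism `Φ₀^ℝ(Y) ≃* Φ₀(Y)^rlf` onto L1's realification — and `Φ₀(Y)^rlf` is cancellative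
(abc-iut-L1 `IsPerfFactorial.Rlf.isCancelMul`); cancellativity transports along the isomorphism.  So `hInt` can
be dropped from every consumer stated over `treeMonoidVocab` (`RealifiedDivisorMonoids.isCancelMul_ΦR`, and
`TemperedFrobenioid.isCancelMul_ΦRlog` for the restriction `Φ^{ℝ-log} = Φ₀^ℝ|_D`).
HONEST FRAMING: refereed pre-IUT material; nothing here bears on [IUTchIII] Cor. 3.12.
-/

namespace Literature.AnabelianGeometry.EtaleTheta

open CategoryTheory Opposite Literature.AlgebraicGeometry.Frobenioids Function

universe u₀ v₀ u v w

/-- Cancellativity transports along an injective multiplicative map (Mathlib `Function.Injective.isCancelMul`).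
[folklore] -/
private theorem isCancelMul_of_injective_mulHom {M N : Type*} [Mul M] [Mul N] [IsCancelMul N]
    (f : M →ₙ* N) (hf : Injective f) : IsCancelMul M :=
  hf.isCancelMul f (map_mul f)

namespace RealifiedDivisorMonoids

variable {D₀ : Type u₀} [Category.{v₀} D₀] (T : RealifiedDivisorMonoids (D₀ := D₀) treeMonoidVocab.{w})

/-- **`Φ₀^ℝ(Y)` is integral at the tree's vocabulary, for EVERY Def 3.6 (i) datum** (`hInt` discharged):
`T.isRealification Y` exhibits `Φ₀^ℝ(Y) ≃* Φ₀(Y)^rlf`, and the realification of a perf-factorial monoid is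
cancellative ([FrdI] Def 2.4 (i)(c)). [cite: MochizukiEtTh2009, Def 3.6 p.76] -/
theorem isCancelMul_ΦR (Y : D₀ᵒᵖ) : IsCancelMul (T.ΦR.obj Y) := by
  obtain ⟨h, e, -⟩ := T.isRealification Y
  haveI : IsCancelMul h.Rlf := IsPerfFactorial.Rlf.isCancelMul h
  exact isCancelMul_of_injective_mulHom (e : T.ΦR.obj Y →ₙ* h.Rlf) e.injective

/-- `hInt` in the binder shape of `Sec3Def36NonzeroConstants` / `Sec3Thm37RatStdOfLine`, for every `T` at the
tree's vocabulary. [cite: MochizukiEtTh2009, Def 3.6 p.76] -/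
theorem hInt_treeMonoidVocab : ∀ Y : D₀ᵒᵖ, IsCancelMul (T.ΦR.obj Y) := fun Y => T.isCancelMul_ΦR Y

end RealifiedDivisorMonoids

namespace TemperedFrobenioid

variable {D₀ : Type u₀} [Category.{v₀} D₀] {T : RealifiedDivisorMonoids (D₀ := D₀) treeMonoidVocab.{w}}
  {D : Type u} [Category.{v} D] {VD : FrdICatStub.{u, v, w} D} (C : TemperedFrobenioid T D VD)

/-- **`Φ^{ℝ-log}(A) = Φ₀^ℝ(Y_A)` is integral** for every tempered Frobenioid at the tree's vocabulary.
[cite: MochizukiEtTh2009, Def 3.6 p.76] -/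
theorem isCancelMul_ΦRlog (A : Dᵒᵖ) : IsCancelMul (C.ΦRlog.obj A) := T.isCancelMul_ΦR (C.baseOp A)

/-- Hence the divisor monoid `Φ(A) ⊆ Φ^{ℝ-log}(A)` of a tempered Frobenioid at the tree's vocabulary is integral as
a submonoid of an integral monoid (independently of the route through perf-factoriality used in
`Sec3HullFaithful`). [cite: MochizukiEtTh2009, Def 3.6 p.77] -/
theorem isCancelMul_divisorMonoid' (A : Dᵒᵖ) : IsCancelMul (C.divisorMonoid.obj A) := by
  haveI := C.isCancelMul_ΦRlog A
  exact isCancelMul_of_injective_mulHom ((C.Φ.carrier A).subtype : C.Φ.carrier A →ₙ* C.ΦRlog.obj A)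
    Subtype.val_injective

end TemperedFrobenioid

end Literature.AnabelianGeometry.EtaleTheta
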